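import Summits.BirchSwinnertonDyer.BirchSwinnertonDyer.Theorems.SignedBaseChangeAnticyclotomicEisensteinDivisibilityAdmdefHowardRigidity
import Summits.BirchSwinnertonDyer.BirchSwinnertonDyer.Theorems.SignedBaseChangeAnticyclotomicEisensteinDivisibilityAdmdefHowardRootEquivalence
import HarnessLib

/-!
# Line `admdef` (crux `AnticyclotomicEisensteinDivisibility`, stmt-BirchSwinnertonDyer-20727): Howard's Theorem 3.2.3 (b) mod 𝔪 on cell β AS AN EQUIVALENCE at every
# indefinite vertex — «given [NV]: `κ_1(∏s)_0 ≠ 0 ⟺ s` has total canonical rank one» — via the RANK-ONE DICTIONARY at a general level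
# (`Sel^ε_{∏s}(K_0, E[p]) = ℤ·x₀`, `x₀ ≠ 0` ⟹ `dim SelQP s ⁺ + dim SelQP s ⁻ = 1`)

LEAD seat bsd-line-sbc-p1 (gen 32), `--supports stmt-BirchSwinnertonDyer-20727` (helper; OFF the v24 composition path; companion of `…AdmdefHowardRigidity`).
`…AdmdefHowardRigidity.kappa_ne_zero_of_hasUnitLambda_of_rank_one` gives «total rank one ⟹ `κ ≠ 0`» from [NV]; LEAD g31's `…AdmdefKolyvaginVertex` gives
«`κ_1(n)_0 ≠ 0 ⟹ Sel^ε_n(K_0, E[p]) = ℤ·κ_1(n)_0`».  The missing link is the rank-one dictionary at level `s` between the two currencies (g29–g30 had it at the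
root only, in classical currency): §1 here.  With it Howard's Theorem 3.2.3 (b) is an IFF at every even vertex (§2), as (c) is at every odd vertex
(`…AdmdefHowardRigidity.isUnit_lam_iff_selQP_eq_bot_of_hasUnitLambda`).

* §1 ★ `finrank_selQP_add_eq_one_of_line` — on cell β ({HLV 3.7 local}, all-ramified, `AcSigned.Setting`, `c ≠ 1`): if `Sel^ε_{∏s}(K_0, E[p])` is a `ℤ`-line
  `ℤ·x₀` with `x₀ ≠ 0` then `dim_𝔽p SelQP s ⁺ + dim_𝔽p SelQP s ⁻ = 1`.  Proof: the sign-free level space `D_s = T⁻¹(Sel^ε)` (g32 dictionaries) is the `ℤ`-line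
  `ℤ·X₀`, `T X₀ = x₀`; `D_s` is `c`-stable, so `c X₀ = a₀ X₀` with `p ∣ a₀² − 1`, i.e. `c X₀ = ± X₀`: `X₀` is an EIGENCLASS of some sign `μ₀`; then
  `SelQP s μ₀ = ℤ·X₀` is an `𝔽_p`-line (g31's `finrank_toZModSubmodule_eq_one_of_line`) and `SelQP s (¬μ₀) = 0` (a class of both signs is killed by `2`,
  `p` odd).
* §2 ★★★ `finrank_add_eq_one_iff_kappa_ne_zero_of_hasUnitLambda` — given [NV] and the hypotheses of `…AdmdefHowardRigidity` §3, at every EVEN level `s`: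
  `dim SelQP s ⁺ + dim SelQP s ⁻ = 1 ⟺ κ_1(∏s)_0 ≠ 0` (⟸ needs neither [NV] nor the PT fact: Kolyvagin at the vertex + §1).

HONEST FRAMING: theorems only (0 definitions, 0 named facts introduced, 0 `sorry`; standard axioms); CONDITIONAL on the named print facts displayed
(audit `proof.conditional`); [NV] is a hypothesis; nothing about K1 (item stmt-BirchSwinnertonDyer-33118), the crux or BSD is proved; no summit statement is proved.

References: [cite: Howard2006, Thm. 3.2.3 (b), Thm. 2.3.7] [cite: Howard2006Bipartite, Thm. 2.5.1] [cite: CastellaEtAl2025, Thm. 7.4, Thm. 7.5 (arXiv:2308.10474v2 pp. 30–31)]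
[cite: WZhang2014, §5, Thm. 9.1] [cite: GrossLMS1991, Thm. 2.2, §5 (5.1)] [cite: HatleyLeiVigni2022, Lemma 3.7] [cite: MilneADT2006, Ch. I, Thm. 4.10]
-/

-- D-0017: single-problem summit, the namespace repeats the problem name by design.
set_option linter.dupNamespace false
set_option autoImplicit false

noncomputable section

open scoped Classical NumberField Pointwise

namespace Summit.BirchSwinnertonDyer.BirchSwinnertonDyer.Theorems.SignedBaseChangeAcDivAdmdefHowardRigidityIndefinite

open CategoryTheory WeierstrassCurve NumberField IsDedekindDomain Field Module
open Literature.NumberTheory.EllipticCurves Literature.NumberTheory.GaloisRepresentations Literature.NumberTheory.GaloisCohomology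
open Literature.NumberTheory.EllipticCurves.CastellaHsuKunduLeeLiu2025
open Literature.NumberTheory.EllipticCurves.BertoliniDarmon2005
open Literature.NumberTheory.EllipticCurves.AcSigned
open Summit.BirchSwinnertonDyer.BirchSwinnertonDyer.Theorems.AdditiveKoly
open Summit.BirchSwinnertonDyer.Rank1Residual.X11b.Three.Koly.Method2
open Summit.BirchSwinnertonDyer.BirchSwinnertonDyer.Theorems.SignedBaseChangeAcDivAdmdefCoreRootOfSeenAnchor
open Summit.BirchSwinnertonDyer.BirchSwinnertonDyer.Theorems.SignedBaseChangeAcDivAdmdefSelmerBookkeeping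
open Summit.BirchSwinnertonDyer.BirchSwinnertonDyer.Theorems.SignedBaseChangeAcDivAdmdefLayerZeroDictionary
open Summit.BirchSwinnertonDyer.BirchSwinnertonDyer.Theorems.SignedBaseChangeAcDivAdmdefKolyvaginVertex
open Summit.BirchSwinnertonDyer.BirchSwinnertonDyer.Theorems.SignedBaseChangeAcDivAdmdefHowardRootEquivalence
open Summit.BirchSwinnertonDyer.BirchSwinnertonDyer.Theorems.SignedBaseChangeAcDivAdmdefZeroVertexDictionary
open Summit.BirchSwinnertonDyer.BirchSwinnertonDyer.Theorems.SignedBaseChangeAcDivAdmdefHowardRigidity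
open scoped ContRepresentation

universe u

variable {K : Type} [Field K] [NumberField K] {W : WeierstrassCurve ℚ} [W.IsElliptic] [W.IsGloballyMinimal] {p : ℕ} [Fact p.Prime]
  {κ : ZpExtension K p} {γ : absoluteGaloisGroup K} {N : ℕ} {ε : ℤˣ} {B : SignedBipartiteSystem W K p κ} {𝔭 𝔭' : HeightOneSpectrum (𝓞 K)}
  (c : K ≃ₐ[ℚ] K) [Module (ZMod p) (Vp W K p)]

/-! ## §1 The rank-one dictionary at a general level: `Sel^ε_{∏s}(K_0, E[p]) = ℤ·x₀ ⟹ dim SelQP s ⁺ + dim SelQP s ⁻ = 1` -/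

/-- ★ **THE RANK-ONE DICTIONARY AT LEVEL `s`.**  On cell β (`AcSigned.Setting`, (Heeg), {HLV 2022 Lemma 3.7, local form}, `p ≥ 5`, `(N : ℤ) = N_E`, `(N, d_K) = 1`,
binder (ii) all-ramified, `c ≠ 1`): if CHKLL25's bottom signed Selmer group `Sel^ε_{∏s}(K_0, E[p])` is the `ℤ`-line through a non-zero class `x₀`, then W. Zhang's
two eigen-spaces at the level `s` have `dim_𝔽p SelQP W K p c s ⁺ + dim_𝔽p SelQP W K p c s ⁻ = 1`.  (The lift `X₀` of `x₀` spans the `c`-stable sign-free level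
space `D_s`, so it is an eigenclass of SOME sign `μ₀` — `c X₀ = a₀ X₀`, `p ∣ a₀² − 1` —; `SelQP s μ₀ = ℤ·X₀` is an `𝔽_p`-line and `SelQP s (¬μ₀) = 0`.)
[cite: GrossLMS1991, Thm. 2.2, §5 (5.1)] [cite: WZhang2014, §5] [cite: Howard2006, Thm. 2.3.7] [cite: HatleyLeiVigni2022, Lemma 3.7] -/
theorem finrank_selQP_add_eq_one_of_line (hS : Setting W K p κ 𝔭 𝔭') (hH : SatisfiesHeegnerHypothesis (W.conductorNorm ℤ) K)
    (hloc : hatleyLeiVigni2022_lemma37_local_signedCondition_eq_kummer W K p κ 𝔭 𝔭') (h5 : 5 ≤ p) (hN : (N : ℤ) = W.conductorNorm ℤ)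
    (hND : IsCoprime (N : ℤ) (NumberField.discr K))
    (hall : ∀ q : ℕ, q.Prime → q ∣ N → ∃ v' : HeightOneSpectrum (𝓞 ℚ), ((q : ℕ) : 𝓞 ℚ) ∈ v'.asIdeal ∧
      ∃ 𝔓 ∈ v'.primesAbove, ∃ σ ∈ 𝔓.inertia (absoluteGaloisGroup ℚ), ∃ P : W.geomTorsion (p : ℤ), σ • P ≠ P)
    (hc1 : c ≠ 1) (ε : ℤˣ) {s : Finset (AdmQ W K p)}
    {x₀ : (W.baseChange K).torsionH1Over ((p : ℤ) ^ 1) (κ.layerSubgroup 0)}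
    (hx₀ : x₀ ∈ signedOrdSelmerTorsion (W.baseChange K) p κ ε (∏ q ∈ s, (q : ℕ)) 0 1) (hx₀0 : x₀ ≠ 0)
    (hline : ∀ y ∈ signedOrdSelmerTorsion (W.baseChange K) p κ ε (∏ q ∈ s, (q : ℕ)) 0 1, ∃ a : ℤ, y = a • x₀) :
    finrank (ZMod p) (SelQP W K p c s true) + finrank (ZMod p) (SelQP W K p c s false) = 1 := by
  have hp : p.Prime := Fact.out
  have hp2 : p ≠ 2 := by omega
  have hK := hS.isImaginaryQuadratic
  have hKc : ∀ w : InfinitePlace K, w.IsComplex := hK.2.isComplex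
  have hcc : c * c = 1 :=
    (algEquiv_eq_one_or_eq_of_finrank_two hK.1 hc1 (c * c)).elim id
      fun h ↦ absurd (mul_left_cancel (h.trans (mul_one c).symm)) hc1
  set τ := conjAct W c ((p ^ 1 : ℕ) : ℤ) with hτ
  have hττ : ∀ X, τ (τ X) = X := conjAct_conjAct_of_mul_self W hcc ((p ^ 1 : ℕ) : ℤ)
  have hdict := mem_levelBlocks_iff_resH1Hom_mem W κ hS hH hloc h5 hN hND hall ε s
  -- the lift `X₀` spans `D_s`
  obtain ⟨X₀, hX₀⟩ := exists_resH1Hom_layerZero_eq W κ x₀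
  have hX₀0 : X₀ ≠ 0 := fun h ↦ hx₀0 (by rw [← hX₀, h, map_zero])
  have hX₀D := (hdict X₀).mpr (by rw [hX₀]; exact hx₀)
  have hDline : ∀ X, X ∈ ((⨅ (w : InfinitePlace K), selmerLocalKer (W.baseChange K) w.Completion ((p ^ 1 : ℕ) : ℤ)) ⊓
      ((⨅ (v : HeightOneSpectrum (𝓞 K)) (_ : ∀ q ∈ ((s.image Subtype.val : Finset ℕ) : Set ℕ) ∪ (∅ : Set ℕ), (q : 𝓞 K) ∉ v.asIdeal),
          selmerLocalKer (W.baseChange K) (v.adicCompletion K) ((p ^ 1 : ℕ) : ℤ)) ⊓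
      (⨅ (q : ℕ) (_ : q ∈ s.image Subtype.val ∧ q ∉ (∅ : Set ℕ)) (v : HeightOneSpectrum (𝓞 K)) (_ : (q : 𝓞 K) ∈ v.asIdeal),
          toricLocalKer (W.baseChange K) (v.adicCompletion K) ((p ^ 1 : ℕ) : ℤ)))) → ∃ a : ℤ, X = a • X₀ := by
    intro X hX
    obtain ⟨a, ha⟩ := hline _ ((hdict X).mp hX)
    refine ⟨a, ?_⟩
    by_contra hne
    apply res_layerZero_ne_zero W κ (sub_ne_zero.mpr hne)
    rw [map_sub, map_zsmul, hX₀, ha, sub_self]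
  -- `X₀` is an eigenclass of some sign
  have hpX₀ : (p : ℤ) • X₀ = 0 := prime_smul_eq_zero W K p X₀
  obtain ⟨a₀, ha₀⟩ := hDline (τ X₀) (conjAct_mem_levelBlocks W p c hKc (s.image Subtype.val) hX₀D)
  have hsq : (a₀ * a₀ - 1) • X₀ = 0 := by
    have h1 : X₀ = (a₀ * a₀) • X₀ := by
      conv_lhs => rw [← hττ X₀, ha₀, map_zsmul, ha₀, ← mul_zsmul]
    rw [sub_zsmul, one_zsmul, ← h1]
    abel
  have hdvd : (p : ℤ) ∣ a₀ * a₀ - 1 := by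
    by_contra hnd
    exact hX₀0 (eq_zero_of_zsmul_eq_zero_of_not_dvd (p := p) hp hpX₀ hsq hnd)
  have hfac : a₀ * a₀ - 1 = (a₀ - 1) * (a₀ + 1) := by ring
  rw [hfac] at hdvd
  have hsign : ∃ μ₀ : Bool, τ X₀ = sgnP μ₀ • X₀ := by
    rcases (Int.prime_iff_natAbs_prime.mpr (by simpa using hp)).dvd_or_dvd hdvd with h | h
    · refine ⟨true, ?_⟩
      obtain ⟨k, hk⟩ := h
      rw [show sgnP true = (1 : ℤ) from rfl, ha₀, show a₀ = 1 + (p : ℤ) * k by linarith, add_zsmul, one_zsmul, mul_comm, mul_zsmul,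
        hpX₀, zsmul_zero, add_zero]
    · refine ⟨false, ?_⟩
      obtain ⟨k, hk⟩ := h
      rw [show sgnP false = (-1 : ℤ) from rfl, ha₀, show a₀ = -1 + (p : ℤ) * k by linarith, add_zsmul, mul_comm, mul_zsmul, hpX₀,
        zsmul_zero, add_zero]
  obtain ⟨μ₀, hμ₀⟩ := hsign
  -- the `μ₀`-eigen-space is the line `ℤ·X₀`
  have hX₀mem : X₀ ∈ levelSelmerSubgroupP W K p c (s.image Subtype.val) ∅ μ₀ := by
    rw [levelSelmerSubgroupP_eq_ker_inf]
    refine AddSubgroup.mem_inf.mpr ⟨?_, hX₀D⟩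
    rw [AddMonoidHom.mem_ker]
    show τ X₀ - sgnP μ₀ • X₀ = 0
    rw [hμ₀, sub_self]
  have hlineμ : ∀ X ∈ levelSelmerSubgroupP W K p c (s.image Subtype.val) ∅ μ₀, ∃ a : ℤ, X = a • X₀ := by
    intro X hX
    rw [levelSelmerSubgroupP_eq_ker_inf] at hX
    exact hDline X (AddSubgroup.mem_inf.mp hX).2
  have hone : finrank (ZMod p) (SelQP W K p c s μ₀) = 1 :=
    finrank_toZModSubmodule_eq_one_of_line _ hX₀mem hX₀0 hlineμ
  -- the other eigen-space is zero (a class of both signs is killed by `2`, `p` odd)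
  have hbot : SelQP W K p c s (!μ₀) = ⊥ := by
    refine (Submodule.eq_bot_iff _).mpr fun X hX ↦ ?_
    have hX' : X ∈ levelSelmerSubgroupP W K p c (s.image Subtype.val) ∅ (!μ₀) := by
      unfold SelQP at hX; rwa [AddSubgroup.mem_toZModSubmodule] at hX
    rw [levelSelmerSubgroupP_eq_ker_inf] at hX'
    obtain ⟨hker, hXD⟩ := AddSubgroup.mem_inf.mp hX'
    have hsgn' : τ X = sgnP (!μ₀) • X := by
      rw [AddMonoidHom.mem_ker] at hker
      exact sub_eq_zero.mp hker
    obtain ⟨a, rfl⟩ := hDline X hXD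
    have hsgn : τ (a • X₀) = sgnP μ₀ • (a • X₀) := by rw [map_zsmul, hμ₀, smul_comm]
    have hdiff : (sgnP μ₀ - sgnP (!μ₀)) • (a • X₀) = 0 := by
      rw [sub_zsmul, ← hsgn, ← hsgn']
      abel
    have hval : sgnP μ₀ - sgnP (!μ₀) = 2 ∨ sgnP μ₀ - sgnP (!μ₀) = -2 := by cases μ₀ <;> decide
    have hp5 : (5 : ℤ) ≤ p := by exact_mod_cast h5
    have hnd : ¬ (p : ℤ) ∣ (sgnP μ₀ - sgnP (!μ₀)) := by
      rcases hval with h | h <;> rw [h] <;> intro hd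
      · have := Int.le_of_dvd (by norm_num) hd
        omega
      · have := Int.le_of_dvd (by norm_num) (Int.dvd_neg.mp hd)
        omega
    exact eq_zero_of_zsmul_eq_zero_of_not_dvd (p := p) hp (prime_smul_eq_zero W K p (a • X₀)) hdiff hnd
  have hzero : finrank (ZMod p) (SelQP W K p c s (!μ₀)) = 0 := by rw [hbot, finrank_bot]
  cases μ₀
  · have h0 : finrank (ZMod p) (SelQP W K p c s true) = 0 := hzero
    omega
  · have h0 : finrank (ZMod p) (SelQP W K p c s false) = 0 := hzero
    omega

/-! ## §2 Howard's Theorem 3.2.3 (b) as an IFF at every indefinite vertex -/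

/-- ★★★ **HOWARD'S THEOREM 3.2.3 (b) mod `𝔪` ON CELL β AS AN EQUIVALENCE at every indefinite vertex: given [NV], `dim SelQP s ⁺ + dim SelQP s ⁻ = 1 ⟺
κ_1(∏s)_0 ≠ 0`** for every EVEN level `s` (hypotheses as in `…AdmdefHowardRigidity.isUnit_lam_of_hasUnitLambda_of_selQP_eq_bot`).  ⟹ is
`kappa_ne_zero_of_hasUnitLambda_of_rank_one` (core graph connected + propagation from the [NV] seed); ⟸ is Kolyvagin at the vertex (g31
`eq_zsmul_kappa_of_mem_signedOrdSelmerTorsion_of_lemma37_local`: `Sel^ε_{∏s}(K_0, E[p]) = ℤ·κ_1(∏s)_0`) + §1 (needs neither [NV] nor the PT fact).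
[cite: Howard2006, Thm. 3.2.3 (b)–(c), Thm. 2.3.7] [cite: Howard2006Bipartite, Thm. 2.5.1] [cite: CastellaEtAl2025, Thm. 7.4, Thm. 7.5] [cite: GrossLMS1991, Thm. 2.2]
[cite: MilneADT2006, Ch. I, Thm. 4.10] [cite: HatleyLeiVigni2022, Lemma 3.7] -/
theorem finrank_add_eq_one_iff_kappa_ne_zero_of_hasUnitLambda (hB : IsSignedBipartiteSystem W K p κ γ N ε B) (hS : Setting W K p κ 𝔭 𝔭')
    (hloc : hatleyLeiVigni2022_lemma37_local_signedCondition_eq_kummer W K p κ 𝔭 𝔭') (hPT : poitouTate_selmerStructure_duality K)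
    (hN : (N : ℤ) = W.conductorNorm ℤ) (h5 : 5 ≤ p) (hsurj : W.HasSurjectiveModNGaloisRep p)
    (hH : SatisfiesHeegnerHypothesis (W.conductorNorm ℤ) K) (hsp : ((Ideal.span {(p : ℤ)}).primesOver (𝓞 K)).ncard = 2)
    (hND : IsCoprime (N : ℤ) (NumberField.discr K))
    (hall : ∀ q : ℕ, q.Prime → q ∣ N → ∃ v' : HeightOneSpectrum (𝓞 ℚ), ((q : ℕ) : 𝓞 ℚ) ∈ v'.asIdeal ∧
      ∃ 𝔓 ∈ v'.primesAbove, ∃ σ ∈ 𝔓.inertia (absoluteGaloisGroup ℚ), ∃ P : W.geomTorsion (p : ℤ), σ • P ≠ P)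
    (hc1 : c ≠ 1) (hodd : Odd (finrank (ZMod p) (SelQP W K p c ∅ true) + finrank (ZMod p) (SelQP W K p c ∅ false)))
    (hNV : B.HasUnitLambda N) {s : Finset (AdmQ W K p)} (hs : Even s.card) :
    finrank (ZMod p) (SelQP W K p c s true) + finrank (ZMod p) (SelQP W K p c s false) = 1 ↔ B.kappa 1 (∏ r ∈ s, (r : ℕ)) 0 ≠ 0 := by
  refine ⟨kappa_ne_zero_of_hasUnitLambda_of_rank_one c hB hS hloc hPT hN h5 hsurj hH hsp hND hall hc1 hodd hNV hs, fun hκ0 ↦ ?_⟩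
  have hn := prod_mem_indefProducts_of_even (W := W) (K := K) (p := p) hN hs
  exact finrank_selQP_add_eq_one_of_line c hS hH hloc h5 hN hND hall hc1 ε (kappa_layer_mem_signedOrdSelmerTorsion hB one_pos hn 0) hκ0
    (eq_zsmul_kappa_of_mem_signedOrdSelmerTorsion_of_lemma37_local hB hS hloc hN h5 hsurj hH hsp hND hall hn hκ0)

end Summit.BirchSwinnertonDyer.BirchSwinnertonDyer.Theorems.SignedBaseChangeAcDivAdmdefHowardRigidityIndefinite

end
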